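import Mathlib
import HarnessLib
import Summits.NavierStokesRegularity.NavierStokesRegularity.Theorems.TaylorModelRungThreeCertificateStageNumericsSound
import Summits.NavierStokesRegularity.NavierStokesRegularity.Theorems.TaylorModelRungThreeCertificateStatic

/-!
# Crux K1b-DR (stmt-NavierStokesRegularity-23954), line `taylor-model` — certificate SOUNDNESS for the `Static`
# block, part 1: surrogates, scalar clauses, power inequalities, and the table class `InTableClass R α`

From `checkStaticAux = true`: `2^(-7(Kb+1)/4) ≤ φ u1`, `2^(-5(Kb+1)/2) ≤ φ u2`, `φ gLo ≤ √(φ Cg) ≤ φ gHi`,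
`2^(5/2 + φ θ) ≤ φ q52 < 2^7` (rpow algebra). From `checkStaticScalars = true`: the scalar conjuncts of
`CertData.Static (toCertData φ T)`, `M > 0 ∧ W ≥ 0` on the window, and the three power inequalities. From
`checkSymm/checkCancel/checkCompar = true`: `InTableClass (φ R) (toCertData φ T).α` (the shift set is enumerated
through the table order `shifts` and its five permutation index maps). Window envelopes via `sn_M`/`sn_W` of
`…CertificateStageNumericsSound` (typer g31's block) by name.

MODEL-lattice rung TL-M3 only; nothing here is a statement about the Navier–Stokes equations.
-/

-- the sub-problem namespace repeats the summit name by design (D-0017)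
set_option linter.dupNamespace false

namespace Summit.NavierStokesRegularity.NavierStokesRegularity.Theorems.TaylorModelCert

open scoped BigOperators
open Literature.Analysis.FluidPDE.TaoCascade Literature.Analysis.FluidPDE.TaoCascade.TaylorChain

namespace CertTables

/-! ### The surrogates -/

section Aux

variable {K : Type} [Field K] [LinearOrder K] {φ : K →+* ℝ} (hφ : Monotone φ) (T : CertTables K)
  (B : StaticAux K)
include hφ

/-- What `checkStaticAux` certifies, as real statements. [folklore] -/
theorem staticAux_sound (h : T.checkStaticAux B = true) :
    0 ≤ T.Kb ∧ 1 ≤ T.Ka ∧ 0 ≤ φ T.Cg ∧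
      (2:ℝ) ^ (-(7:ℝ) / 4 * ((T.Kb:ℝ) + 1)) ≤ φ B.u1 ∧ (2:ℝ) ^ (-(5:ℝ) / 2 * ((T.Kb:ℝ) + 1)) ≤ φ B.u2 ∧
      0 ≤ φ B.gLo ∧ φ B.gLo ≤ Real.sqrt (φ T.Cg) ∧ Real.sqrt (φ T.Cg) ≤ φ B.gHi ∧
      0 ≤ φ B.q52 ∧ (2:ℝ) ^ ((5:ℝ) / 2 + φ T.θ) ≤ φ B.q52 ∧ φ B.q52 < 2 ^ 7 := by
  simp only [checkStaticAux, Bool.and_eq_true, decide_eq_true_eq] at h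
  obtain ⟨⟨⟨⟨⟨⟨⟨⟨⟨⟨⟨⟨⟨⟨⟨hKb, hKa⟩, hCg⟩, hden⟩, hθ⟩, hu10⟩, hu1⟩, hu20⟩, hu2⟩, hg0⟩, hg⟩, hG0⟩, hG⟩, hq0⟩,
    hq⟩, hq7⟩ := h
  have two : φ 2 = 2 := map_ofNat φ 2
  -- `x ≥ 0`, `y ≤ x^n`, `n ≠ 0`, `0 ≤ y` ⟹ `y^(1/n) ≤ x`
  have rootle : ∀ {x y : ℝ} {n : ℕ}, 0 ≤ x → 0 ≤ y → n ≠ 0 → y ≤ x ^ n → y ^ ((n : ℝ)⁻¹) ≤ x := by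
    intro x y n hx hy hn h
    have := Real.rpow_le_rpow hy h (inv_nonneg.2 (Nat.cast_nonneg n))
    rwa [Real.pow_rpow_inv_natCast hx hn] at this
  have eKb : (((T.Kb + 1).toNat : ℕ) : ℝ) = (T.Kb : ℝ) + 1 := by
    have := Int.toNat_of_nonneg (show 0 ≤ T.Kb + 1 by omega)
    exact_mod_cast this
  have hθr : φ T.θ = (B.θnum : ℝ) / (B.θden : ℝ) := by
    have e := congrArg φ hθ
    rw [map_mul, map_natCast, map_natCast] at e
    rw [eq_div_iff (by exact_mod_cast hden.ne')]
    exact e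
  refine ⟨hKb, hKa, phi_nonneg hφ hCg, ?_, ?_, phi_nonneg hφ hg0, ?_, ?_, phi_nonneg hφ hq0, ?_, ?_⟩
  · -- 2^(-7/4 (Kb+1)) ≤ u1 :  (2^(-7(Kb+1)))^(1/4) ≤ u1  from  2^(-7(Kb+1)) ≤ u1^4
    have hx0 : 0 ≤ φ B.u1 := phi_nonneg hφ hu10
    have h1 : 1 ≤ φ B.u1 ^ 4 * (2:ℝ) ^ (7 * (T.Kb + 1).toNat) := by
      have := hφ hu1; simpa [map_mul, map_pow, two] using this
    have hpos : 0 < (2:ℝ) ^ (7 * (T.Kb + 1).toNat) := by positivity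
    have h2 : ((2:ℝ) ^ (7 * (T.Kb + 1).toNat))⁻¹ ≤ φ B.u1 ^ 4 := by
      rw [inv_le_iff_one_le_mul₀ hpos]; linarith [h1]
    have h3 := rootle hx0 (by positivity) (by norm_num : (4:ℕ) ≠ 0) h2
    refine le_trans (le_of_eq ?_) h3
    rw [← Real.rpow_natCast, ← Real.rpow_neg (by norm_num), ← Real.rpow_mul (by norm_num)]
    congr 1
    push_cast
    rw [eKb]
    ring
  · -- 2^(-5/2 (Kb+1)) ≤ u2
    have hx0 : 0 ≤ φ B.u2 := phi_nonneg hφ hu20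
    have h1 : 1 ≤ φ B.u2 ^ 2 * (2:ℝ) ^ (5 * (T.Kb + 1).toNat) := by
      have := hφ hu2; simpa [map_mul, map_pow, two] using this
    have hpos : 0 < (2:ℝ) ^ (5 * (T.Kb + 1).toNat) := by positivity
    have h2 : ((2:ℝ) ^ (5 * (T.Kb + 1).toNat))⁻¹ ≤ φ B.u2 ^ 2 := by
      rw [inv_le_iff_one_le_mul₀ hpos]; linarith [h1]
    have h3 := rootle hx0 (by positivity) (by norm_num : (2:ℕ) ≠ 0) h2
    refine le_trans (le_of_eq ?_) h3
    rw [← Real.rpow_natCast, ← Real.rpow_neg (by norm_num), ← Real.rpow_mul (by norm_num)]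
    congr 1
    push_cast
    rw [eKb]
    ring
  · -- gLo ≤ √Cg
    have h1 : φ B.gLo ^ 2 ≤ φ T.Cg := by have := hφ hg; simpa [map_pow] using this
    calc φ B.gLo = Real.sqrt (φ B.gLo ^ 2) := (Real.sqrt_sq (phi_nonneg hφ hg0)).symm
      _ ≤ Real.sqrt (φ T.Cg) := Real.sqrt_le_sqrt h1
  · -- √Cg ≤ gHi
    have h1 : φ T.Cg ≤ φ B.gHi ^ 2 := by have := hφ hG; simpa [map_pow] using this
    calc Real.sqrt (φ T.Cg) ≤ Real.sqrt (φ B.gHi ^ 2) := Real.sqrt_le_sqrt h1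
      _ = φ B.gHi := Real.sqrt_sq (phi_nonneg hφ hG0)
  · -- 2^(5/2 + θ) ≤ q52
    have hx0 : 0 ≤ φ B.q52 := phi_nonneg hφ hq0
    have h1 : (2:ℝ) ^ (5 * B.θden + 2 * B.θnum) ≤ φ B.q52 ^ (2 * B.θden) := by
      have := hφ hq; simpa [map_pow, two] using this
    have hn : 2 * B.θden ≠ 0 := by omega
    have h3 := rootle hx0 (by positivity) hn h1
    refine le_trans (le_of_eq ?_) h3
    rw [← Real.rpow_natCast, ← Real.rpow_mul (by norm_num)]
    congr 1
    rw [hθr]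
    have : (B.θden : ℝ) ≠ 0 := by exact_mod_cast hden.ne'
    field_simp
    push_cast
    ring
  · have := phi_strictMono hφ hq7
    simpa [map_pow, two] using this

end Aux

/-! ### Projections of the global design data -/

section Proj

variable {K : Type} [Field K] (φ : K →+* ℝ) (T : CertTables K)

/-- The structure constants of the interpreted record at a shift of the table order. [folklore] -/
theorem alpha_shifts (a b i : Fin 4) {μi : ℕ} (hμ : μi < 4) :
    (T.toCertData φ).α a b i (shifts.getD μi (0, 0, 0)) = φ (T.αt a.val b.val i.val μi) := by
  rw [T.toCertData_α φ, shifts_getD μi hμ, if_pos hμ]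
  rfl

end Proj

/-! ### SCALARS and the power inequalities -/

section Scalars

variable {K : Type} [Field K] [LinearOrder K] {φ : K →+* ℝ} (hφ : Monotone φ) (T : CertTables K)
  (B : StaticAux K)
include hφ

/-- Soundness of `checkStaticScalars` (with `checkStaticAux`): the scalar conjuncts of `Static`, positivity of the
envelopes on the window, and the three power inequalities. [folklore] -/
theorem static_scalars (haux : T.checkStaticAux B = true) (h : T.checkStaticScalars B = true) :
    1 ≤ (T.toCertData φ).R ∧ (T.toCertData φ).X₀ (T.toCertData φ).i₀ ≠ 0 ∧
    0 ≤ (T.toCertData φ).θ ∧ (T.toCertData φ).θ < 1 / 2 ∧ 0 < (T.toCertData φ).c ∧ 0 < (T.toCertData φ).η₀ ∧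
    (T.toCertData φ).η₀ ≤ 1 ∧ 0 < (T.toCertData φ).Cb ∧ 0 < (T.toCertData φ).Cg ∧ 0 ≤ (T.toCertData φ).Kb ∧
    1 ≤ (T.toCertData φ).Ka ∧ 0 < (T.toCertData φ).τs ∧ (T.toCertData φ).τs ≤ (T.toCertData φ).c ∧
    0 < (T.toCertData φ).mm ∧
    (∀ k, -(T.toCertData φ).Kb ≤ k → k ≤ (T.toCertData φ).Ka → 0 < (T.toCertData φ).M k ∧ 0 ≤ (T.toCertData φ).W k) ∧
    (T.toCertData φ).c * (68 * (T.toCertData φ).Cb * (2:ℝ) ^ (-(7:ℝ) / 4 * (((T.toCertData φ).Kb:ℝ) + 1)) +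
      47 * (T.toCertData φ).M (-(T.toCertData φ).Kb) * (2:ℝ) ^ (-(5:ℝ) / 2 * (((T.toCertData φ).Kb:ℝ) + 1))) ≤ 1 / 8 ∧
    2560 * (T.toCertData φ).c * (T.toCertData φ).M (T.toCertData φ).Ka ^ 2 * (2:ℝ) ^ (6 * ((T.toCertData φ).Ka:ℝ)) ≤
      Real.sqrt (T.toCertData φ).Cg ∧
    51200 * (T.toCertData φ).c * Real.sqrt (T.toCertData φ).Cg ≤ (2:ℝ) ^ (((T.toCertData φ).Ka:ℝ) + 2) := by
  obtain ⟨hKb, hKa, hCg0, hu1, hu2, hg0, hg, hG, -, -, -⟩ := T.staticAux_sound hφ B haux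
  simp only [checkStaticScalars, allN_eq_true, Bool.and_eq_true, Bool.not_eq_true', decide_eq_false_iff_not,
    decide_eq_true_eq] at h
  obtain ⟨⟨⟨⟨⟨⟨⟨⟨⟨⟨⟨⟨⟨⟨⟨⟨⟨hR, hX⟩, hθ0⟩, hθ⟩, hc⟩, hη0⟩, hη1⟩, hCb⟩, hCg⟩, -⟩, -⟩, hτ0⟩, hτc⟩, hmm⟩, hMW⟩, hP1⟩,
    hP2⟩, hP3⟩ := h
  have two : φ 2 = 2 := map_ofNat φ 2
  have hwin : ∀ k, -T.Kb ≤ k → k ≤ T.Ka → 0 < φ (T.Mw (k + T.Kb).toNat) ∧ 0 ≤ φ (T.Ww (k + T.Kb).toNat) := by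
    intro k hk1 hk2
    have hlt : (k + T.Kb).toNat < T.m := T.toNat_shell_lt_m ⟨hk1, hk2⟩
    obtain ⟨h1, h2⟩ := hMW _ hlt
    exact ⟨phi_pos hφ h1, phi_nonneg hφ h2⟩
  have hc' : 0 < φ T.c := phi_pos hφ hc
  refine ⟨by simpa [toCertData] using hφ hR, ?_, by simpa [toCertData] using phi_nonneg hφ hθ0, ?_,
    by simpa [toCertData] using hc', by simpa [toCertData] using phi_pos hφ hη0, ?_,
    by simpa [toCertData] using phi_pos hφ hCb, by simpa [toCertData] using phi_pos hφ hCg, hKb, hKa,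
    by simpa [toCertData] using phi_pos hφ hτ0, by simpa [toCertData] using hφ hτc,
    by simpa [toCertData] using phi_pos hφ hmm, ?_, ?_, ?_, ?_⟩
  · -- X₀ i₀ ≠ 0
    show φ (vget T.X₀ T.i₀.val) ≠ 0
    exact fun h0 => hX (φ.injective (by rw [h0, map_zero]))
  · have := phi_strictMono hφ hθ
    simpa [toCertData, map_div₀, two] using this
  · simpa [toCertData] using hφ hη1
  · intro k hk1 hk2
    rw [T.sn_M φ ⟨hk1, hk2⟩, T.sn_W φ ⟨hk1, hk2⟩]
    exact hwin k hk1 hk2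
  · -- first power inequality
    have hMb : (T.toCertData φ).M (-T.Kb) = φ (T.Mw 0) := by
      rw [T.sn_M φ ⟨le_refl _, by omega⟩]; simp
    show φ T.c * (68 * φ T.Cb * (2:ℝ) ^ (-(7:ℝ) / 4 * ((T.Kb:ℝ) + 1)) +
      47 * (T.toCertData φ).M (-T.Kb) * (2:ℝ) ^ (-(5:ℝ) / 2 * ((T.Kb:ℝ) + 1))) ≤ 1 / 8
    rw [hMb]
    have h1 := hφ hP1
    simp only [map_mul, map_add, map_div₀, map_ofNat, map_one] at h1
    have hM0 : 0 ≤ φ (T.Mw 0) := (hwin (-T.Kb) (le_refl _) (by omega)).1.le |> fun h => by simpa using h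
    have hCb' : 0 ≤ φ T.Cb := (phi_pos hφ hCb).le
    have e1 : 68 * φ T.Cb * (2:ℝ) ^ (-(7:ℝ) / 4 * ((T.Kb:ℝ) + 1)) ≤ 68 * φ T.Cb * φ B.u1 :=
      mul_le_mul_of_nonneg_left hu1 (by positivity)
    have e2 : 47 * φ (T.Mw 0) * (2:ℝ) ^ (-(5:ℝ) / 2 * ((T.Kb:ℝ) + 1)) ≤ 47 * φ (T.Mw 0) * φ B.u2 :=
      mul_le_mul_of_nonneg_left hu2 (by positivity)
    calc φ T.c * (68 * φ T.Cb * (2:ℝ) ^ (-(7:ℝ) / 4 * ((T.Kb:ℝ) + 1)) +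
          47 * φ (T.Mw 0) * (2:ℝ) ^ (-(5:ℝ) / 2 * ((T.Kb:ℝ) + 1)))
        ≤ φ T.c * (68 * φ T.Cb * φ B.u1 + 47 * φ (T.Mw 0) * φ B.u2) :=
          mul_le_mul_of_nonneg_left (add_le_add e1 e2) hc'.le
      _ ≤ 1 / 8 := h1
  · -- second power inequality
    have hMa : (T.toCertData φ).M T.Ka = φ (T.Mw (T.m - 1)) := by
      rw [T.sn_M φ ⟨by omega, le_refl _⟩]
      congr 3
      have := T.m_eq_of_InW (k := T.Ka) ⟨by omega, le_refl _⟩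
      omega
    have eKa0 : ((T.Ka.toNat : ℕ) : ℝ) = (T.Ka : ℝ) := by
      have := Int.toNat_of_nonneg (show 0 ≤ T.Ka by omega)
      exact_mod_cast this
    have eKa : (6 * (T.Ka:ℝ)) = ((6 * T.Ka.toNat : ℕ) : ℝ) := by
      push_cast; rw [eKa0]
    show 2560 * φ T.c * (T.toCertData φ).M T.Ka ^ 2 * (2:ℝ) ^ (6 * (T.Ka:ℝ)) ≤ Real.sqrt (φ T.Cg)
    rw [hMa, eKa, Real.rpow_natCast]
    have h1 := hφ hP2
    simp only [map_mul, map_pow, map_ofNat] at h1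
    exact h1.trans hg
  · -- third power inequality
    have eKa : ((T.Ka:ℝ) + 2) = (((T.Ka + 2).toNat : ℕ) : ℝ) := by
      have := Int.toNat_of_nonneg (show 0 ≤ T.Ka + 2 by omega)
      exact_mod_cast this.symm
    show 51200 * φ T.c * Real.sqrt (φ T.Cg) ≤ (2:ℝ) ^ ((T.Ka:ℝ) + 2)
    rw [eKa, Real.rpow_natCast]
    have h1 := hφ hP3
    simp only [map_mul, map_pow, map_ofNat] at h1
    exact le_trans (mul_le_mul_of_nonneg_left hG (by positivity)) h1

end Scalars

/-! ### The table class -/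

section TableClass

variable {K : Type} [Field K] [LinearOrder K] {φ : K →+* ℝ} (hφ : Monotone φ) (T : CertTables K)
include hφ

omit [LinearOrder K] hφ in
/-- The shift set enumerated by the table order. [folklore] -/
theorem exists_shifts_of_mem {μ : ℤ × ℤ × ℤ} (hμ : μ ∈ shiftSet) : ∃ μi, μi < 4 ∧ μ = shifts.getD μi (0, 0, 0) := by
  rcases (mem_shiftSet_iff μ).1 hμ with rfl | rfl | rfl | rfl
  · exact ⟨0, by norm_num, rfl⟩
  · exact ⟨1, by norm_num, rfl⟩
  · exact ⟨2, by norm_num, rfl⟩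
  · exact ⟨3, by norm_num, rfl⟩

omit [LinearOrder K] hφ in
/-- The five coordinate permutations of a shift, in the table order. [folklore] -/
theorem perm_shifts {μi : ℕ} (hμ : μi < 4) :
    let μ := shifts.getD μi ((0:ℤ), (0:ℤ), (0:ℤ))
    (μ.1, μ.2.2, μ.2.1) = shifts.getD (p132 μi) (0, 0, 0) ∧ p132 μi < 4 ∧
    (μ.2.1, μ.1, μ.2.2) = shifts.getD (p213 μi) (0, 0, 0) ∧ p213 μi < 4 ∧
    (μ.2.1, μ.2.2, μ.1) = shifts.getD (p231 μi) (0, 0, 0) ∧ p231 μi < 4 ∧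
    (μ.2.2, μ.1, μ.2.1) = shifts.getD (p312 μi) (0, 0, 0) ∧ p312 μi < 4 ∧
    (μ.2.2, μ.2.1, μ.1) = shifts.getD (p321 μi) (0, 0, 0) ∧ p321 μi < 4 := by
  interval_cases μi <;> decide

/-- Soundness of the three table checks: `InTableClass R α` for the interpreted record. [folklore] -/
theorem static_tableClass (hR : 1 ≤ T.R) (hS : T.checkSymm = true) (hC : T.checkCancel = true)
    (hP : T.checkCompar = true) : InTableClass (T.toCertData φ).R (T.toCertData φ).α := by
  simp only [checkSymm, checkCancel, checkCompar, allN_eq_true, Bool.and_eq_true, Bool.or_eq_true,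
    decide_eq_true_eq] at hS hC hP
  have hR' : 0 < φ T.R := lt_of_lt_of_le one_pos (by simpa using hφ hR)
  refine ⟨?_, ?_, ?_⟩
  · -- symmetry (4.2)
    intro i₁ i₂ i₃ μ₁ μ₂ μ₃ hμ
    obtain ⟨μi, hμi, hμe⟩ := exists_shifts_of_mem hμ
    obtain ⟨-, -, h213, h213', -⟩ := perm_shifts hμi
    have c1 : μ₁ = (shifts.getD μi ((0:ℤ), (0:ℤ), (0:ℤ))).1 := by rw [← hμe]
    have c2 : μ₂ = (shifts.getD μi ((0:ℤ), (0:ℤ), (0:ℤ))).2.1 := by rw [← hμe]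
    have c3 : μ₃ = (shifts.getD μi ((0:ℤ), (0:ℤ), (0:ℤ))).2.2 := by rw [← hμe]
    have e1 : ((μ₂, μ₁, μ₃) : ℤ × ℤ × ℤ) = shifts.getD (p213 μi) (0, 0, 0) := by rw [← h213, c1, c2, c3]
    rw [hμe, e1, T.alpha_shifts φ i₁ i₂ i₃ hμi, T.alpha_shifts φ i₂ i₁ i₃ h213']
    exact congrArg φ (hS i₁.val i₁.isLt i₂.val i₂.isLt i₃.val i₃.isLt μi hμi)
  · -- cancellation (4.3)
    intro i₁ i₂ i₃ μ₁ μ₂ μ₃ hμ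
    obtain ⟨μi, hμi, hμe⟩ := exists_shifts_of_mem hμ
    obtain ⟨h132, h132', h213, h213', h231, h231', h312, h312', h321, h321'⟩ := perm_shifts hμi
    have c1 : μ₁ = (shifts.getD μi ((0:ℤ), (0:ℤ), (0:ℤ))).1 := by rw [← hμe]
    have c2 : μ₂ = (shifts.getD μi ((0:ℤ), (0:ℤ), (0:ℤ))).2.1 := by rw [← hμe]
    have c3 : μ₃ = (shifts.getD μi ((0:ℤ), (0:ℤ), (0:ℤ))).2.2 := by rw [← hμe]
    have e132 : ((μ₁, μ₃, μ₂) : ℤ × ℤ × ℤ) = shifts.getD (p132 μi) (0, 0, 0) := by rw [← h132, c1, c2, c3]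
    have e213 : ((μ₂, μ₁, μ₃) : ℤ × ℤ × ℤ) = shifts.getD (p213 μi) (0, 0, 0) := by rw [← h213, c1, c2, c3]
    have e231 : ((μ₂, μ₃, μ₁) : ℤ × ℤ × ℤ) = shifts.getD (p231 μi) (0, 0, 0) := by rw [← h231, c1, c2, c3]
    have e312 : ((μ₃, μ₁, μ₂) : ℤ × ℤ × ℤ) = shifts.getD (p312 μi) (0, 0, 0) := by rw [← h312, c1, c2, c3]
    have e321 : ((μ₃, μ₂, μ₁) : ℤ × ℤ × ℤ) = shifts.getD (p321 μi) (0, 0, 0) := by rw [← h321, c1, c2, c3]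
    rw [hμe, e132, e213, e231, e312, e321, T.alpha_shifts φ _ _ _ hμi, T.alpha_shifts φ _ _ _ h132',
      T.alpha_shifts φ _ _ _ h213', T.alpha_shifts φ _ _ _ h231', T.alpha_shifts φ _ _ _ h312',
      T.alpha_shifts φ _ _ _ h321']
    have := congrArg φ (hC i₁.val i₁.isLt i₂.val i₂.isLt i₃.val i₃.isLt μi hμi)
    simpa [map_add] using this
  · -- comparability
    intro i₁ i₂ i₃ μ hμ
    obtain ⟨μi, hμi, hμe⟩ := exists_shifts_of_mem hμ
    rw [hμe, T.alpha_shifts φ i₁ i₂ i₃ hμi]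
    obtain ⟨h1, h2⟩ := hP i₁.val i₁.isLt i₂.val i₂.isLt i₃.val i₃.isLt μi hμi
    refine ⟨?_, ?_⟩
    · have := hφ h1; rwa [phi_abs hφ, map_one] at this
    · rcases h2 with h2 | h2
      · left; rw [h2, map_zero]
      · right
        have := hφ h2
        rw [map_one, map_mul, phi_abs hφ] at this
        show (φ T.R)⁻¹ ≤ _
        rw [inv_le_iff_one_le_mul₀' hR']
        linarith

end TableClass

end CertTables

end Summit.NavierStokesRegularity.NavierStokesRegularity.Theorems.TaylorModelCert
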